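import Literature.Analysis.FluidPDE.SereginSverakMeridionalScaledEnergy
import Literature.Analysis.FluidPDE.KNSSNoAxisymmetricTypeIHolds
import HarnessLib

/-!
# Seregin–Šverák 2009, Proposition 3.7 and Theorem 1.1 with the Type I rate on the meridional
# velocity only, given the swirl bound (as7)

G. Seregin, V. Šverák, *On Type I singularities of the local axi-symmetric solutions of the
Navier–Stokes equations*, Comm. PDE 34 (2009) 171–201 = arXiv:0804.1803 (labels and pages refer
to the arXiv version). Theorem 1.1 (p. 3) asserts regularity of an axis point `z₀` of an axially
symmetric weak solution `v ∈ L₃`, `q ∈ L_{3/2}`, under (1.1) (p. 2): the Type I rate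
`√(t₀ - t)|v̄(x,t)|` bounded on `Q(z₀,R)` for the MERIDIONAL part `v̄ = v_ϱ e_ϱ + v₃ e₃` only. Its
printed proof (§3–§4) runs: Lemma 3.3 (App. II: the swirl `Γ = ϱ v_φ` is bounded on `Q(1/2)`,
(as1)/(as7)), Lemma 3.5 (scaled energies bounded along the axis, (as4)), Proposition 3.7
(`|v| ≤ C₁/|x'|` on `Q(1/8)`), and §4 (blow-up at a singular origin to a bounded ancient
axisymmetric solution with `|y'||w| ≤ A₂`, killed by KNSS 2009, Thm. 5.3).

The tree DISCHARGES this chain with the rate (r3) on the full velocity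
(`SereginSverak2009.isRegularAtOrigin_of_typeI`, `…AxisDecayBound_holds`, `…OffAxisBound_holds`,
`…BlowupAlternative_holds`, `KNSS2009_liouville_bound_C_over_r_holds`) and records Thm. 1.1 with
the meridional rate as the named fact `SereginSverak2009.MeridionalTypeIRegularity` (not
discharged: Lemma 3.3 = the Moser iteration of App. II is not in the tree). This file PROVES the
remaining two steps of the printed proof with the swirl bound (as7) `|Γ| ≤ C₂` a.e. on `Q` taken
as an INPUT (as in `SereginSverakMeridionalCubic.lean`, `SereginSverakMeridionalScaledEnergy.lean`):

* `SereginSverak2009.axisDecay_meridional` — Proposition 3.7 under (1.1) + (r2) + (as7):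
  `|x'| ‖u‖ ≤ A₂` a.e. on `Q(1/16)`. Proof as printed (p. 10): near the parabola,
  `|x'| ≤ (7/4)√(-t)`, the rate on `ū` and `|x'||u_φ| = |Γ| ≤ C₂` give `|x'||u| ≤ (7/4)C + C₂`;
  off it, `z` lies in a shell `Q¹_{r₀}(b₀)` on which the off-axis bound after (as15)
  (`OffAxisBound_holds`: `r₀|u| ≤ Φ((A+E+C+D)(z_{b₀},3r₀))`, Seregin–Zajaczkowski 2007 Prop. 4.1)
  applies, the functionals being bounded by Lemma 3.5 (`scaledEnergyBound_meridional`). The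
  tree's `OffAxisBound` is typed over the Type I class (its proof uses (r3) only through local
  boundedness); it is therefore applied to the time-shifted zooms
  `u^{α}(s,y) = ½ u(-α + s/4, y/2)` ("scaling arguments", §3 p. 9, §4 p. 11), which are BOUNDED
  on `Q` by (r2) — hence trivially in the Type I class — and satisfy (1.1), (r2), (as7) with the
  same constants and `‖u^α‖₃³, ‖p^α‖_{3/2}^{3/2} ≤ 4(‖u‖₃³, ‖p‖_{3/2}^{3/2})`, so that Lemma 3.5 bounds
  their functionals UNIFORMLY in the shift `α`; countably many shells `(α, r₀, b₀) ∈ ℚ³` cover.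
* `SereginSverak2009.isRegularAtOrigin_of_meridionalTypeI_of_swirlBound` (and `…_half`, with
  the swirl bound on `Q(1/2)` only, the printed reach of Lemma 3.3, by re-scaling) — Theorem 1.1 / 3.1
  under (1.1) + (r2) + (as7), assembled as in §4 (p. 11) exactly as `isRegularAtOrigin_of_typeI`:
  local (p1) from Lemma 3.5 at `b = 0` (`exists_scaledEnergyBound_meridional`), local (p2) from
  `axisDecay_meridional`, the blow-up step `BlowupAlternative_holds` and the Liouville theorem
  `KNSS2009_liouville_bound_C_over_r_holds`.

What is NOT proved here: Lemma 3.3 (the swirl bound from the weak hypotheses). For classical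
solutions blowing up at time `T` the swirl bound is the maximum principle for `Γ`
(`abs_swirl_le_of_classical`), which is how `SereginSverakMeridionalTypeIClassical.lean` makes the
classical corollaries of `MeridionalTypeIRegularity` unconditional. No named facts are introduced.

## References

* G. Seregin, V. Šverák, Comm. PDE 34 (2009) 171–201, arXiv:0804.1803: §1 (1.1), Thm 1.1
  (pp. 2–3); §3 Lemma 3.3, Remark 3.4, Lemma 3.5, Prop. 3.7 and its proof (pp. 9–10); §4 (p. 11).
  [`SereginSverak2009`]
* G. Seregin, W. Zajaczkowski, SIAM J. Math. Anal. 39 (2007) 669–685, Prop. 4.1.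
  [`SereginZajaczkowski2007`]
* G. Koch, N. Nadirashvili, G. Seregin, V. Šverák, Acta Math. 203 (2009) 83–105, Thm 5.3.
  [`KochNadirashviliSereginSverak2009`]
-/

noncomputable section

open MeasureTheory Set Function Filter Topology TopologicalSpace Module
open scoped NNReal ENNReal

namespace Literature.Analysis.FluidPDE

namespace SereginSverak2009

/-! ### The cylindrical frame under the zoom about an axis point -/

/-- **The swirl under the zoom about an axis point**: for `x₀` on the axis,
`R · Γ[y ↦ α v(x₀ + R y)](y) = α · Γ[v](x₀ + R y)` (`Γ = x₁v₂ - x₂v₁` is homogeneous of degree one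
in `x'`). [cite: SereginSverak2009, §3 p. 9 (Γ = ϱ v_φ) and §4 p. 11 (the axis-centred rescaling)] -/
theorem swirl_axis_zoom {x₀ : EuclideanSpace ℝ (Fin 3)} (hx₀ : cylRadius x₀ = 0) (α R : ℝ)
    (v : EuclideanSpace ℝ (Fin 3) → EuclideanSpace ℝ (Fin 3)) (y : EuclideanSpace ℝ (Fin 3)) :
    R * swirl (fun y' => α • v (x₀ + R • y')) y = α * swirl v (x₀ + R • y) := by
  obtain ⟨h0, h1⟩ := (cylRadius_eq_zero_iff x₀).1 hx₀
  simp only [swirl, PiLp.add_apply, PiLp.smul_apply, smul_eq_mul, h0, h1, zero_add]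
  ring

/-- The Navier–Stokes zoom (`α = R`) about an axis point leaves the swirl invariant:
`Γ[y ↦ c v(x₀ + c y)](y) = Γ[v](x₀ + c y)`. [cite: SereginSverak2009, §3 p. 9 and §4 p. 11] -/
theorem swirl_axis_zoom_self {x₀ : EuclideanSpace ℝ (Fin 3)} (hx₀ : cylRadius x₀ = 0) (c : ℝ)
    (v : EuclideanSpace ℝ (Fin 3) → EuclideanSpace ℝ (Fin 3)) (y : EuclideanSpace ℝ (Fin 3)) :
    swirl (fun y' => c • v (x₀ + c • y')) y = swirl v (x₀ + c • y) := by
  obtain ⟨h0, h1⟩ := (cylRadius_eq_zero_iff x₀).1 hx₀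
  simp only [swirl, PiLp.add_apply, PiLp.smul_apply, smul_eq_mul, h0, h1, zero_add]
  ring

/-- The centre `0 · e₃` of the shift-and-zoom of `SereginSverakRescaledHypotheses` lies on the
axis. [cite: SereginSverak2009, §4 p. 11] -/
theorem cylRadius_zero_smul_eZ : cylRadius ((0 : ℝ) • eZ : EuclideanSpace ℝ (Fin 3)) = 0 := by
  rw [zero_smul]
  exact (cylRadius_eq_zero_iff _).2 ⟨rfl, rfl⟩

/-! ### The hypotheses (1.1), (as7) and the Type I class under the time-shifted zoom -/

section ShiftZoom

variable {u : ℝ → EuclideanSpace ℝ (Fin 3) → EuclideanSpace ℝ (Fin 3)}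

/-- **(1.1) is preserved by the shift-and-zoom** `Φ(s, y) = (t₀ + c² s, c y)`, `0 < c ≤ 1`,
`t₀ ≤ 0`, `t₀ - c² ≥ -1`, with the same constant: `ū` commutes with the zoom
(`poloidalPart_axis_zoom`) and `c √(-s) ≤ √(-(t₀ + c² s))` because `t₀ ≤ 0`.
[cite: SereginSverak2009, §1 (1.1) (arXiv p. 2) and §3 p. 9 (scaling)] -/
theorem ae_meridionalRate_shiftZoom {C : ℝ}
    (hC : ∀ᵐ z ∂(volume.restrict (parCyl 0 1)),
      Real.sqrt (-z.1) * ‖poloidalPart (u z.1) z.2‖ ≤ C)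
    {c t₀ : ℝ} (hc : 0 < c) (hc1 : c ≤ 1) (ht₀ : t₀ ≤ 0) (ht₁ : -1 ≤ t₀ - c ^ 2) :
    ∀ᵐ z ∂(volume.restrict (parCyl 0 1)),
      Real.sqrt (-z.1) *
        ‖poloidalPart ((c • stPull (c ^ 2) c t₀ ((0 : ℝ) • eZ) u) z.1) z.2‖ ≤ C := by
  have h1 := ae_restrict_preimage_stAffine (sq_pos_of_pos hc) hc t₀ ((0 : ℝ) • eZ) hC
  filter_upwards [ae_restrict_of_ae_restrict_of_subset
    (parCyl_one_subset_preimage hc hc1 ht₀ ht₁) h1,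
    ae_restrict_mem (isOpen_parCyl 0 1).measurableSet] with z hz hzQ
  rw [stAffine_fst, stAffine_snd] at hz
  have hs0 : z.1 < 0 := (mem_parCyl_zero.1 hzQ).1.2
  have hfun : (c • stPull (c ^ 2) c t₀ ((0 : ℝ) • eZ) u) z.1 =
      fun y => c • u (t₀ + c ^ 2 * z.1) ((0 : ℝ) • eZ + c • y) := rfl
  rw [hfun, poloidalPart_axis_zoom cylRadius_zero_smul_eZ hc c (u (t₀ + c ^ 2 * z.1)) z.2,
    norm_smul, Real.norm_eq_abs, abs_of_pos hc]
  have key : Real.sqrt (-z.1) * c ≤ Real.sqrt (-(t₀ + c ^ 2 * z.1)) := by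
    have e : Real.sqrt (-z.1) * c = Real.sqrt (-z.1 * c ^ 2) := by
      rw [Real.sqrt_mul (by linarith) (c ^ 2), Real.sqrt_sq hc.le]
    rw [e]
    exact Real.sqrt_le_sqrt (by nlinarith [pow_pos hc 2])
  calc Real.sqrt (-z.1) * (c * ‖poloidalPart (u (t₀ + c ^ 2 * z.1)) ((0 : ℝ) • eZ + c • z.2)‖)
      = Real.sqrt (-z.1) * c *
          ‖poloidalPart (u (t₀ + c ^ 2 * z.1)) ((0 : ℝ) • eZ + c • z.2)‖ := by ring
    _ ≤ Real.sqrt (-(t₀ + c ^ 2 * z.1)) *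
          ‖poloidalPart (u (t₀ + c ^ 2 * z.1)) ((0 : ℝ) • eZ + c • z.2)‖ :=
        mul_le_mul_of_nonneg_right key (norm_nonneg _)
    _ ≤ C := hz

/-- **(as7) is preserved by the shift-and-zoom** (the swirl `Γ = ϱ u_φ` is scale invariant,
`swirl_axis_zoom_self`): `|Γ[u]| ≤ C₂` a.e. on `Q` gives `|Γ[c u ∘ Φ]| ≤ C₂` a.e. on `Q`.
[cite: SereginSverak2009, §3 Lemma 3.3 (as1)/(as7) (arXiv p. 9) and §3 p. 9 (scaling)] -/
theorem ae_swirlBound_shiftZoom {C₂ : ℝ}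
    (hC₂ : ∀ᵐ z ∂(volume.restrict (parCyl 0 1)), |swirl (u z.1) z.2| ≤ C₂)
    {c t₀ : ℝ} (hc : 0 < c) (hc1 : c ≤ 1) (ht₀ : t₀ ≤ 0) (ht₁ : -1 ≤ t₀ - c ^ 2) :
    ∀ᵐ z ∂(volume.restrict (parCyl 0 1)),
      |swirl ((c • stPull (c ^ 2) c t₀ ((0 : ℝ) • eZ) u) z.1) z.2| ≤ C₂ := by
  have h1 := ae_restrict_preimage_stAffine (sq_pos_of_pos hc) hc t₀ ((0 : ℝ) • eZ) hC₂
  filter_upwards [ae_restrict_of_ae_restrict_of_subset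
    (parCyl_one_subset_preimage hc hc1 ht₀ ht₁) h1] with z hz
  rw [stAffine_fst, stAffine_snd] at hz
  have hfun : (c • stPull (c ^ 2) c t₀ ((0 : ℝ) • eZ) u) z.1 =
      fun y => c • u (t₀ + c ^ 2 * z.1) ((0 : ℝ) • eZ + c • y) := rfl
  rw [hfun, swirl_axis_zoom_self cylRadius_zero_smul_eZ c (u (t₀ + c ^ 2 * z.1)) z.2]
  exact hz

/-- **A time-shifted zoom of a solution satisfying (r2) is in the Type I class of Thm. 3.1**:
for `0 < α < 1`, `0 < c ≤ 1`, `α + c² ≤ 1`, the field `c u(-α + c² s, c y)` is bounded by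
`c K_{√α}` a.e. on `Q` (hypothesis (r2) at `a = √α`), hence `√(-s) ‖·‖ ≤ c K_{√α}` there.
(The Type I hypothesis of the tree's `OffAxisBound` is used only through such local bounds.)
[cite: SereginSverak2009, Thm 3.1 (r3), Thm 3.2 (r2) (arXiv p. 9) and §4 p. 11 ("scaling arguments")] -/
theorem isTypeIOnCyl_shiftZoom (hr2 : IsBoundedAwayFromZero u) {c α : ℝ} (hc : 0 < c)
    (hc1 : c ≤ 1) (hα : 0 < α) (hα1 : α < 1) (ht₁ : -1 ≤ -α - c ^ 2) :
    IsTypeIOnCyl (c • stPull (c ^ 2) c (-α) ((0 : ℝ) • eZ) u) := by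
  have ha : Real.sqrt α ∈ Ioo (0 : ℝ) 1 :=
    ⟨Real.sqrt_pos.2 hα, by rw [Real.sqrt_lt' one_pos]; simpa using hα1⟩
  obtain ⟨K, hK⟩ := hr2 (Real.sqrt α) ha
  refine ⟨c * K, ?_⟩
  have ht₀ : -α ≤ 0 := by linarith
  have h1 := ae_restrict_preimage_stAffine (sq_pos_of_pos hc) hc (-α) ((0 : ℝ) • eZ) hK
  filter_upwards [ae_restrict_of_ae_restrict_of_subset
    (parCyl_one_subset_preimage hc hc1 ht₀ ht₁) h1,
    ae_restrict_mem (isOpen_parCyl 0 1).measurableSet] with z hz hzQ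
  rw [stAffine_fst, stAffine_snd] at hz
  obtain ⟨⟨hs1, hs0⟩, -, -⟩ := mem_parCyl_zero.1 hzQ
  have ht : -α + c ^ 2 * z.1 < -Real.sqrt α ^ 2 := by
    rw [Real.sq_sqrt hα.le]
    nlinarith [pow_pos hc 2]
  have hb : ‖u (-α + c ^ 2 * z.1) ((0 : ℝ) • eZ + c • z.2)‖ ≤ K := hz ht
  rw [smul_stPull_apply, norm_smul, Real.norm_eq_abs, abs_of_pos hc]
  have hsqrt : Real.sqrt (-z.1) ≤ 1 := by
    rw [show (1 : ℝ) = Real.sqrt 1 from Real.sqrt_one.symm]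
    exact Real.sqrt_le_sqrt (by linarith)
  calc Real.sqrt (-z.1) * (c * ‖u (-α + c ^ 2 * z.1) ((0 : ℝ) • eZ + c • z.2)‖)
      ≤ 1 * (c * ‖u (-α + c ^ 2 * z.1) ((0 : ℝ) • eZ + c • z.2)‖) :=
        mul_le_mul_of_nonneg_right hsqrt (by positivity)
    _ ≤ c * K := by
        rw [one_mul]
        exact mul_le_mul_of_nonneg_left hb hc.le

/-- **`L³` bound of the half-zoom**: `∫_Q |½ u ∘ Φ|³ ≤ 4 N₁` when `∫_Q |u|³ ≤ N₁`
(`lintegral_velocity_rescale`, `c = ½`). [cite: SereginSverak2009, §3 p. 9 (scaling)] -/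
theorem lintegral_velocity_halfZoom_le {t₀ N₁ : ℝ} (ht₀ : t₀ ≤ 0) (ht₁ : -1 ≤ t₀ - (2⁻¹ : ℝ) ^ 2)
    (hN₁ : ∫⁻ z in parCyl 0 1, ‖u z.1 z.2‖ₑ ^ (3 : ℕ) ≤ ENNReal.ofReal N₁) :
    ∫⁻ z in parCyl 0 1,
        ‖((2⁻¹ : ℝ) • stPull ((2⁻¹ : ℝ) ^ 2) (2⁻¹ : ℝ) t₀ ((0 : ℝ) • eZ) u) z.1 z.2‖ₑ ^ (3 : ℕ) ≤
      ENNReal.ofReal (4 * N₁) := by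
  have hc : (0 : ℝ) < 2⁻¹ := by norm_num
  have hc1 : (2⁻¹ : ℝ) ≤ 1 := by norm_num
  calc ∫⁻ z in parCyl 0 1,
        ‖((2⁻¹ : ℝ) • stPull ((2⁻¹ : ℝ) ^ 2) (2⁻¹ : ℝ) t₀ ((0 : ℝ) • eZ) u) z.1 z.2‖ₑ ^ (3 : ℕ)
      ≤ ENNReal.ofReal (((2⁻¹ : ℝ) ^ 2)⁻¹) * ∫⁻ z in parCyl 0 1, ‖u z.1 z.2‖ₑ ^ (3 : ℕ) :=
        lintegral_velocity_rescale hc hc1 ht₀ ht₁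
    _ ≤ ENNReal.ofReal (((2⁻¹ : ℝ) ^ 2)⁻¹) * ENNReal.ofReal N₁ := by gcongr
    _ = ENNReal.ofReal (4 * N₁) := by
        rw [← ENNReal.ofReal_mul (by positivity)]
        norm_num

/-- **`L^{3/2}` bound of the half-zoomed pressure**: `∫_Q |¼ p ∘ Φ|^{3/2} ≤ 4 N₂` when
`∫_Q |p|^{3/2} ≤ N₂` (`lintegral_pressure_rescale`, `c = ½`). [cite: SereginSverak2009, §3 p. 9 (scaling)] -/
theorem lintegral_pressure_halfZoom_le {p : ℝ → EuclideanSpace ℝ (Fin 3) → ℝ} {t₀ N₂ : ℝ}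
    (ht₀ : t₀ ≤ 0) (ht₁ : -1 ≤ t₀ - (2⁻¹ : ℝ) ^ 2)
    (hN₂ : ∫⁻ z in parCyl 0 1, ‖p z.1 z.2‖ₑ ^ (3 / 2 : ℝ) ≤ ENNReal.ofReal N₂) :
    ∫⁻ z in parCyl 0 1,
        ‖(((2⁻¹ : ℝ) ^ 2) • stPull ((2⁻¹ : ℝ) ^ 2) (2⁻¹ : ℝ) t₀ ((0 : ℝ) • eZ) p) z.1 z.2‖ₑ ^
          (3 / 2 : ℝ) ≤
      ENNReal.ofReal (4 * N₂) := by
  have hc : (0 : ℝ) < 2⁻¹ := by norm_num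
  have hc1 : (2⁻¹ : ℝ) ≤ 1 := by norm_num
  calc ∫⁻ z in parCyl 0 1,
        ‖(((2⁻¹ : ℝ) ^ 2) • stPull ((2⁻¹ : ℝ) ^ 2) (2⁻¹ : ℝ) t₀ ((0 : ℝ) • eZ) p) z.1 z.2‖ₑ ^
          (3 / 2 : ℝ)
      ≤ ENNReal.ofReal (((2⁻¹ : ℝ) ^ 2)⁻¹) * ∫⁻ z in parCyl 0 1, ‖p z.1 z.2‖ₑ ^ (3 / 2 : ℝ) :=
        lintegral_pressure_rescale hc hc1 ht₀ ht₁
    _ ≤ ENNReal.ofReal (((2⁻¹ : ℝ) ^ 2)⁻¹) * ENNReal.ofReal N₂ := by gcongr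
    _ = ENNReal.ofReal (4 * N₂) := by
        rw [← ENNReal.ofReal_mul (by positivity)]
        norm_num

end ShiftZoom

/-! ### The time-shifted shells -/

/-- `Φ(s, y) = (-α + c² s, c y)` pulls the time-shifted shell `Q¹_{c r₀}(c b₀) - (α, 0)` back to
`Q¹_{r₀}(b₀)` (`c > 0`). [cite: SereginSverak2009, proof of Prop. 3.7 (the shells Q¹_{r₀}(b₀), arXiv p. 10)] -/
theorem stAffine_preimage_shiftedShell {c : ℝ} (hc : 0 < c) (α r₀ b₀ : ℝ) :
    stAffine (c ^ 2) c (-α) ((0 : ℝ) • eZ) ⁻¹'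
        ((fun z : ℝ × EuclideanSpace ℝ (Fin 3) => (z.1 + α, z.2)) ⁻¹'
          innerShell (c * r₀) (c * b₀)) = innerShell r₀ b₀ := by
  have hc2 : 0 < c ^ 2 := by positivity
  ext ⟨s, y⟩
  simp only [mem_preimage, stAffine_apply, mem_innerShell, mem_Ioo, zero_smul, zero_add,
    cylRadius_smul, abs_of_pos hc, PiLp.smul_apply, smul_eq_mul]
  rw [← mul_sub, abs_mul, abs_of_pos hc]
  constructor
  · rintro ⟨⟨h1, h2⟩, ⟨h3, h4⟩, h5⟩
    refine ⟨⟨?_, ?_⟩, ⟨?_, ?_⟩, ?_⟩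
    · nlinarith
    · nlinarith
    · exact lt_of_mul_lt_mul_left h3 hc.le
    · nlinarith
    · exact lt_of_mul_lt_mul_left h5 hc.le
  · rintro ⟨⟨h1, h2⟩, ⟨h3, h4⟩, h5⟩
    refine ⟨⟨?_, ?_⟩, ⟨?_, ?_⟩, ?_⟩
    · nlinarith
    · nlinarith
    · exact mul_lt_mul_of_pos_left h3 hc
    · nlinarith
    · exact mul_lt_mul_of_pos_left h5 hc

/-- The time-shifted shells are measurable. [cite: SereginSverak2009, proof of Prop. 3.7 (arXiv p. 10)] -/
theorem measurableSet_shiftedShell (α r b : ℝ) :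
    MeasurableSet ((fun z : ℝ × EuclideanSpace ℝ (Fin 3) => (z.1 + α, z.2)) ⁻¹' innerShell r b) := by
  have hcont : Continuous fun z : ℝ × EuclideanSpace ℝ (Fin 3) => (z.1 + α, z.2) := by fun_prop
  exact ((isOpen_innerShell r b).preimage hcont).measurableSet

/-! ### Proposition 3.7 under (1.1), (r2) and (as7) -/

/-- **Seregin–Šverák 2009, Proposition 3.7 under the meridional rate (1.1), (r2) and the swirl
bound (as7)**: for `(u, p)` under the standing assumptions of §3 with axial symmetry, (r2),
`√(-t)‖ū‖ ≤ C` a.e. on `Q` and `|Γ| ≤ C₂` a.e. on `Q`, there is `A₂` with `|x'| ‖u(t,x)‖ ≤ A₂` for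
a.e. `(t, x) ∈ Q(1/16)` (printed on `Q(1/8)` for the continuous representative; the radius is
immaterial downstream). Proof as printed (arXiv p. 10) — near the parabola `|x'| ≤ (7/4)√(-t)`
from the rate on `ū` and `|x'||u_φ| = |Γ| ≤ C₂`; off it through the shells `Q¹_{r₀}(b₀)`, the
off-axis bound after (as15) (`OffAxisBound_holds`) and Lemma 3.5 (`scaledEnergyBound_meridional`)
— the off-axis bound being applied to the bounded time-shifted zooms `½ u(-α + s/4, y/2)`,
`α ∈ ℚ ∩ ]0, ½[`, whose functionals Lemma 3.5 bounds uniformly in `α` (module docstring).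
[cite: SereginSverak2009, Prop. 3.7 and its proof (arXiv p. 10), with (1.1) (p. 2), (r2) and (as7) (p. 9)] -/
theorem axisDecay_meridional
    {u : ℝ → EuclideanSpace ℝ (Fin 3) → EuclideanSpace ℝ (Fin 3)}
    {p : ℝ → EuclideanSpace ℝ (Fin 3) → ℝ}
    (hsol : IsAxisymmetricLocalSolution u p) (hr2 : IsBoundedAwayFromZero u)
    (hmer : IsMeridionalTypeIOnCyl u)
    (hsw : ∃ C₂ : ℝ, ∀ᵐ z ∂(volume.restrict (parCyl 0 1)), |swirl (u z.1) z.2| ≤ C₂) :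
    ∃ A₂ : ℝ, ∀ᵐ z ∂(volume.restrict (parCyl 0 (1 / 16))), cylRadius z.2 * ‖u z.1 z.2‖ ≤ A₂ := by
  obtain ⟨C, hC⟩ := hmer
  obtain ⟨C₂, hC₂⟩ := hsw
  -- the global norms and the uniform constant of Lemma 3.5 for the half-zooms
  set N₁ : ℝ := (∫⁻ z in parCyl 0 1, ‖u z.1 z.2‖ₑ ^ (3 : ℕ)).toReal with hN₁
  set N₂ : ℝ := (∫⁻ z in parCyl 0 1, ‖p z.1 z.2‖ₑ ^ (3 / 2 : ℝ)).toReal with hN₂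
  have hN₁' : ∫⁻ z in parCyl 0 1, ‖u z.1 z.2‖ₑ ^ (3 : ℕ) ≤ ENNReal.ofReal N₁ := by
    rw [hN₁, ENNReal.ofReal_toReal hsol.velocity_L3.ne]
  have hN₂' : ∫⁻ z in parCyl 0 1, ‖p z.1 z.2‖ₑ ^ (3 / 2 : ℝ) ≤ ENNReal.ofReal N₂ := by
    rw [hN₂, ENNReal.ofReal_toReal hsol.pressure_L32.ne]
  obtain ⟨C₁, hC₁⟩ := scaledEnergyBound_meridional C C₂ (4 * N₁) (4 * N₂)
  obtain ⟨Φ, -, hΦ⟩ := OffAxisBound_holds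
  have hc : (0 : ℝ) < 2⁻¹ := by norm_num
  have hc1 : (2⁻¹ : ℝ) ≤ 1 := by norm_num
  -- the off-axis bound on every admissible time-shifted rational shell
  have hshell : ∀ α r₀ b₀ : ℚ, (0 : ℝ) < α → (α : ℝ) < 1 / 2 → (0 : ℝ) < r₀ →
      (r₀ : ℝ) < 1 / 12 → |(b₀ : ℝ)| < 1 / 8 →
      ∀ᵐ z ∂(volume : Measure (ℝ × EuclideanSpace ℝ (Fin 3))),
        z ∈ (fun z : ℝ × EuclideanSpace ℝ (Fin 3) => (z.1 + (α : ℝ), z.2)) ⁻¹'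
            innerShell (2⁻¹ * (r₀ : ℝ)) (2⁻¹ * (b₀ : ℝ)) →
          (r₀ : ℝ) * (2⁻¹ * ‖u z.1 z.2‖) ≤ Φ C₁ := by
    intro α r₀ b₀ hα0 hα1 hr0 hr12 hb0
    have ht₀ : -(α : ℝ) ≤ 0 := by linarith
    have ht₁ : (-1 : ℝ) ≤ -(α : ℝ) - (2⁻¹ : ℝ) ^ 2 := by norm_num; linarith
    -- the time-shifted half-zoom and its hypotheses
    set v := (2⁻¹ : ℝ) • stPull ((2⁻¹ : ℝ) ^ 2) (2⁻¹ : ℝ) (-(α : ℝ)) ((0 : ℝ) • eZ) u with hv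
    set q := ((2⁻¹ : ℝ) ^ 2) • stPull ((2⁻¹ : ℝ) ^ 2) (2⁻¹ : ℝ) (-(α : ℝ)) ((0 : ℝ) • eZ) p
      with hq
    have hsol' : IsAxisymmetricLocalSolution v q :=
      isAxisymmetricLocalSolution_rescale hsol hc hc1 ht₀ ht₁
    have hr2' : IsBoundedAwayFromZero v := isBoundedAwayFromZero_rescale hr2 hc hc1 ht₀ ht₁
    have hI' : IsTypeIOnCyl v := isTypeIOnCyl_shiftZoom hr2 hc hc1 hα0 (by linarith) ht₁
    have hrate' := ae_meridionalRate_shiftZoom hC hc hc1 ht₀ ht₁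
    have hsw' := ae_swirlBound_shiftZoom hC₂ hc hc1 ht₀ ht₁
    have hv3 := lintegral_velocity_halfZoom_le (u := u) ht₀ ht₁ hN₁'
    have hq32 := lintegral_pressure_halfZoom_le (p := p) ht₀ ht₁ hN₂'
    obtain ⟨G', hG', hbd⟩ := hC₁ v q hsol' hr2' hrate' hsw' hv3 hq32
    -- Lemma 3.5 at `z_{b₀}`, radius `3 r₀ < 1/4`
    have hK : energyA ((0 : ℝ), (b₀ : ℝ) • eZ) (3 * r₀) v +
        dissipationE ((0 : ℝ), (b₀ : ℝ) • eZ) (3 * r₀) G' +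
        cubicC ((0 : ℝ), (b₀ : ℝ) • eZ) (3 * r₀) v +
        pressureD ((0 : ℝ), (b₀ : ℝ) • eZ) (3 * r₀) q ≤ C₁ :=
      hbd (b₀ : ℝ) (by linarith [hb0.le]) (3 * r₀) ⟨by positivity, by linarith⟩
    -- the off-axis bound on `Q¹_{r₀}(b₀)` for the zoom, transported back along `Φ`
    have hae := hΦ v q hsol' hI' G' hG' r₀ ⟨hr0, by linarith⟩ b₀ hb0 C₁ hK
    rw [← stAffine_preimage_shiftedShell hc (α : ℝ) (r₀ : ℝ) (b₀ : ℝ)] at hae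
    refine (ae_restrict_iff' (measurableSet_shiftedShell _ _ _)).1
      (ae_restrict_of_ae_restrict_preimage_stAffine (sq_pos_of_pos hc) hc (-(α : ℝ))
        ((0 : ℝ) • eZ)
        (S := (fun z : ℝ × EuclideanSpace ℝ (Fin 3) => (z.1 + (α : ℝ), z.2)) ⁻¹'
          innerShell (2⁻¹ * (r₀ : ℝ)) (2⁻¹ * (b₀ : ℝ)))
        (P := fun z => (r₀ : ℝ) * (2⁻¹ * ‖u z.1 z.2‖) ≤ ((Φ C₁ : ℝ≥0) : ℝ)) ?_)
    filter_upwards [hae] with z hz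
    rw [hv, smul_stPull_apply, norm_smul, Real.norm_eq_abs, abs_of_pos hc] at hz
    exact hz
  have hall : ∀ᵐ z ∂(volume : Measure (ℝ × EuclideanSpace ℝ (Fin 3))), ∀ α r₀ b₀ : ℚ,
      (0 : ℝ) < α → (α : ℝ) < 1 / 2 → (0 : ℝ) < r₀ → (r₀ : ℝ) < 1 / 12 → |(b₀ : ℝ)| < 1 / 8 →
      z ∈ (fun z : ℝ × EuclideanSpace ℝ (Fin 3) => (z.1 + (α : ℝ), z.2)) ⁻¹'
          innerShell (2⁻¹ * (r₀ : ℝ)) (2⁻¹ * (b₀ : ℝ)) →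
        (r₀ : ℝ) * (2⁻¹ * ‖u z.1 z.2‖) ≤ Φ C₁ := by
    refine ae_all_iff.2 fun α => ae_all_iff.2 fun r₀ => ae_all_iff.2 fun b₀ => ?_
    by_cases h : (0 : ℝ) < α ∧ (α : ℝ) < 1 / 2 ∧ (0 : ℝ) < r₀ ∧ (r₀ : ℝ) < 1 / 12 ∧
        |(b₀ : ℝ)| < 1 / 8
    · filter_upwards [hshell α r₀ b₀ h.1 h.2.1 h.2.2.1 h.2.2.2.1 h.2.2.2.2] with z hz _ _ _ _ _
        using hz
    · exact Eventually.of_forall fun z h1 h2 h3 h4 h5 => absurd ⟨h1, h2, h3, h4, h5⟩ h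
  -- (1.1) and (as7), as a.e. statements on `ℝ × ℝ³`
  have hC' : ∀ᵐ z ∂(volume : Measure (ℝ × EuclideanSpace ℝ (Fin 3))), z ∈ parCyl 0 1 →
      Real.sqrt (-z.1) * ‖poloidalPart (u z.1) z.2‖ ≤ C :=
    (ae_restrict_iff' (isOpen_parCyl 0 1).measurableSet).1 hC
  have hC₂' : ∀ᵐ z ∂(volume : Measure (ℝ × EuclideanSpace ℝ (Fin 3))), z ∈ parCyl 0 1 →
      |swirl (u z.1) z.2| ≤ C₂ :=
    (ae_restrict_iff' (isOpen_parCyl 0 1).measurableSet).1 hC₂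
  refine ⟨max (7 / 4 * C + C₂) (2 * Φ C₁),
    (ae_restrict_iff' (isOpen_parCyl 0 (1 / 16)).measurableSet).2 ?_⟩
  filter_upwards [hall, hC', hC₂'] with z hz hzC hzS hz16
  obtain ⟨⟨ht1, ht2⟩, hρ, hx3⟩ := mem_parCyl_zero.1 hz16
  have hzQ : z ∈ parCyl 0 1 := parCyl_mono 0 (by norm_num) (by norm_num) hz16
  have hrate := hzC hzQ
  have hswirl := hzS hzQ
  have hC₂0 : 0 ≤ C₂ := (abs_nonneg _).trans hswirl
  -- `|x'| |u| ≤ |x'| |ū| + |Γ|`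
  have hdec : cylRadius z.2 * ‖u z.1 z.2‖ ≤
      cylRadius z.2 * ‖poloidalPart (u z.1) z.2‖ + C₂ := by
    calc cylRadius z.2 * ‖u z.1 z.2‖
        ≤ cylRadius z.2 * (‖poloidalPart (u z.1) z.2‖ + |swirlVelocity (u z.1) z.2|) :=
          mul_le_mul_of_nonneg_left (norm_le_norm_poloidalPart_add_abs_swirlVelocity _ _)
            (cylRadius_nonneg _)
      _ = cylRadius z.2 * ‖poloidalPart (u z.1) z.2‖ +
            cylRadius z.2 * |swirlVelocity (u z.1) z.2| := mul_add _ _ _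
      _ ≤ cylRadius z.2 * ‖poloidalPart (u z.1) z.2‖ + C₂ :=
          add_le_add le_rfl (cylRadius_mul_abs_swirlVelocity_le hC₂0 hswirl)
  by_cases hcase : cylRadius z.2 ≤ 7 / 4 * Real.sqrt (-z.1)
  · -- near the axis relative to the parabolic scaling: the rate on `ū` and the swirl bound
    have h1 : cylRadius z.2 * ‖poloidalPart (u z.1) z.2‖ ≤ 7 / 4 * C :=
      calc cylRadius z.2 * ‖poloidalPart (u z.1) z.2‖
          ≤ 7 / 4 * Real.sqrt (-z.1) * ‖poloidalPart (u z.1) z.2‖ :=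
            mul_le_mul_of_nonneg_right hcase (norm_nonneg _)
        _ = 7 / 4 * (Real.sqrt (-z.1) * ‖poloidalPart (u z.1) z.2‖) := by ring
        _ ≤ 7 / 4 * C := mul_le_mul_of_nonneg_left hrate (by norm_num)
    calc cylRadius z.2 * ‖u z.1 z.2‖ ≤ 7 / 4 * C + C₂ := by linarith
      _ ≤ max (7 / 4 * C + C₂) (2 * Φ C₁) := le_max_left _ _
  · -- off the axis: a time-shifted rational shell through `z`
    have hcase' : 7 / 4 * Real.sqrt (-z.1) < cylRadius z.2 := not_le.1 hcase
    have hsqrt0 : 0 ≤ Real.sqrt (-z.1) := Real.sqrt_nonneg _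
    have hϱ : 0 < cylRadius z.2 := by linarith
    -- the radius `r₀ ∈ ]ϱ, min(2ϱ, 1/12)[`
    have hrrange : cylRadius z.2 < min (2 * cylRadius z.2) (1 / 12) :=
      lt_min (by linarith) (by linarith)
    obtain ⟨r₀, hr1, hr2⟩ := exists_rat_btwn hrrange
    have hr_2ϱ : (r₀ : ℝ) < 2 * cylRadius z.2 := lt_of_lt_of_le hr2 (min_le_left _ _)
    have hr_12 : (r₀ : ℝ) < 1 / 12 := lt_of_lt_of_le hr2 (min_le_right _ _)
    have hr_pos : (0 : ℝ) < r₀ := hϱ.trans hr1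
    -- the height `b₀` with `|2 x₃ - b₀| < r₀`, `|b₀| < 1/8`
    obtain ⟨hx3l, hx3r⟩ := abs_lt.1 hx3
    have hbrange : max (2 * z.2 2 - r₀) (-(1 / 8)) < min (2 * z.2 2 + r₀) (1 / 8) :=
      max_lt (lt_min (by linarith) (by linarith)) (lt_min (by linarith) (by norm_num))
    obtain ⟨b₀, hb1, hb2⟩ := exists_rat_btwn hbrange
    have hb_lo : 2 * z.2 2 - r₀ < b₀ := lt_of_le_of_lt (le_max_left _ _) hb1
    have hb_lo' : -(1 / 8) < (b₀ : ℝ) := lt_of_le_of_lt (le_max_right _ _) hb1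
    have hb_hi : (b₀ : ℝ) < 2 * z.2 2 + r₀ := lt_of_lt_of_le hb2 (min_le_left _ _)
    have hb_hi' : (b₀ : ℝ) < 1 / 8 := lt_of_lt_of_le hb2 (min_le_right _ _)
    have hb_abs : |(b₀ : ℝ)| < 1 / 8 := abs_lt.2 ⟨hb_lo', hb_hi'⟩
    -- the shift `α ∈ ]-t - r₀²/4, -t[`, `0 < α < 1/2`
    have hr₀sq : (0 : ℝ) < (r₀ : ℝ) ^ 2 := by positivity
    have ht256 : -z.1 < 1 / 256 := by nlinarith
    have hαrange : max (-z.1 - (r₀ : ℝ) ^ 2 / 4) 0 < min (-z.1) (1 / 2) :=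
      max_lt (lt_min (by linarith) (by linarith)) (lt_min (by linarith) (by norm_num))
    obtain ⟨α, ha1, ha2⟩ := exists_rat_btwn hαrange
    have hα_lo : -z.1 - (r₀ : ℝ) ^ 2 / 4 < α := lt_of_le_of_lt (le_max_left _ _) ha1
    have hα_pos : (0 : ℝ) < α := lt_of_le_of_lt (le_max_right _ _) ha1
    have hα_t : (α : ℝ) < -z.1 := lt_of_lt_of_le ha2 (min_le_left _ _)
    have hα_half : (α : ℝ) < 1 / 2 := lt_of_lt_of_le ha2 (min_le_right _ _)
    -- `z` lies in the time-shifted shell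
    have hmem : z ∈ (fun z : ℝ × EuclideanSpace ℝ (Fin 3) => (z.1 + (α : ℝ), z.2)) ⁻¹'
        innerShell (2⁻¹ * (r₀ : ℝ)) (2⁻¹ * (b₀ : ℝ)) := by
      rw [mem_preimage, mem_innerShell]
      refine ⟨⟨?_, ?_⟩, ⟨?_, ?_⟩, ?_⟩
      · show -(2⁻¹ * (r₀ : ℝ)) ^ 2 < z.1 + α
        nlinarith
      · show z.1 + (α : ℝ) < 0
        linarith
      · show 2⁻¹ * (r₀ : ℝ) < cylRadius z.2
        linarith
      · show cylRadius z.2 < 2 * (2⁻¹ * (r₀ : ℝ))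
        linarith
      · show |z.2 2 - 2⁻¹ * (b₀ : ℝ)| < 2⁻¹ * (r₀ : ℝ)
        rw [abs_lt]
        constructor <;> linarith
    have key : (r₀ : ℝ) * (2⁻¹ * ‖u z.1 z.2‖) ≤ Φ C₁ :=
      hz α r₀ b₀ hα_pos hα_half hr_pos hr_12 hb_abs hmem
    calc cylRadius z.2 * ‖u z.1 z.2‖ ≤ r₀ * ‖u z.1 z.2‖ :=
          mul_le_mul_of_nonneg_right hr1.le (norm_nonneg _)
      _ = 2 * ((r₀ : ℝ) * (2⁻¹ * ‖u z.1 z.2‖)) := by ring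
      _ ≤ 2 * Φ C₁ := by linarith
      _ ≤ max (7 / 4 * C + C₂) (2 * Φ C₁) := le_max_right _ _

/-! ### Theorem 1.1 / 3.1 under (1.1), (r2) and (as7) -/

/-- **Seregin–Šverák 2009, Theorem 1.1 (= Thm 3.1 with the rate on `v̄` only), given the swirl
bound**: under the standing assumptions of §3 with axial symmetry (`IsAxisymmetricLocalSolution`),
(r2) (`IsBoundedAwayFromZero`), the meridional Type I rate (1.1) (`IsMeridionalTypeIOnCyl`) and
the swirl bound (as7) `|Γ| ≤ C₂` a.e. on `Q` (in print the output of Lemma 3.3; here an input),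
the origin is a regular point. Assembled as in §4 (arXiv p. 11), verbatim the tree's
`isRegularAtOrigin_of_typeI`: local (p1) from Lemma 3.5 at `z_b = 0`
(`exists_scaledEnergyBound_meridional`), local (p2) from Prop. 3.7 (`axisDecay_meridional`); were
the origin singular, `BlowupAlternative_holds` would give a non-zero axisymmetric bounded ancient
weak solution with `|y'||w| ≤ A₂`, which KNSS 2009 Thm 5.3
(`KNSS2009_liouville_bound_C_over_r_holds`) forces to vanish. The named fact
`MeridionalTypeIRegularity` is this statement without the hypothesis (as7).
[cite: SereginSverak2009, Thm 1.1 (arXiv p. 3) with (1.1) (p. 2); §3 Lemma 3.5, Prop. 3.7; §4 (p. 11)] -/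
theorem isRegularAtOrigin_of_meridionalTypeI_of_swirlBound
    {u : ℝ → EuclideanSpace ℝ (Fin 3) → EuclideanSpace ℝ (Fin 3)}
    {p : ℝ → EuclideanSpace ℝ (Fin 3) → ℝ}
    (hsol : IsAxisymmetricLocalSolution u p) (hr2 : IsBoundedAwayFromZero u)
    (hmer : IsMeridionalTypeIOnCyl u)
    (hsw : ∃ C₂ : ℝ, ∀ᵐ z ∂(volume.restrict (parCyl 0 1)), |swirl (u z.1) z.2| ≤ C₂) :
    IsRegularAtOrigin u := by
  by_contra hsing
  -- local (p1) from Lemma 3.5 at `z_b = 0`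
  obtain ⟨G, hG, C₁, hC₁⟩ := exists_scaledEnergyBound_meridional hsol hr2 hmer hsw
  have hp1 : ∃ G : ℝ → EuclideanSpace ℝ (Fin 3) →
        EuclideanSpace ℝ (Fin 3) →L[ℝ] EuclideanSpace ℝ (Fin 3),
      HasWeakSpatialGradientOn (parCylOpens 0 1) u G ∧
      ∃ ρ ∈ Ioc (0 : ℝ) 1, ∃ A₁ : ℝ≥0, ∀ r ∈ Ioc (0 : ℝ) ρ,
        energyA 0 r u + dissipationE 0 r G + cubicC 0 r u + pressureD 0 r p ≤ A₁ := by
    refine ⟨G, hG, 1 / 8, ⟨by norm_num, by norm_num⟩, C₁, fun r hr => ?_⟩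
    have hr' : r ∈ Ioo (0 : ℝ) (1 / 4) := ⟨hr.1, by linarith [hr.2]⟩
    have key := hC₁ 0 (by norm_num) r hr'
    simpa only [zero_smul, Prod.mk_zero_zero] using key
  -- local (p2) from Proposition 3.7
  have hp2 : ∃ ρ ∈ Ioc (0 : ℝ) 1, ∃ A₂ : ℝ,
      ∀ᵐ z ∂(volume.restrict (parCyl 0 ρ)), cylRadius z.2 * ‖u z.1 z.2‖ ≤ A₂ :=
    ⟨1 / 16, ⟨by norm_num, by norm_num⟩, axisDecay_meridional hsol hr2 hmer hsw⟩
  -- the blow-up limit, killed by KNSS 2009, Thm. 5.3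
  obtain ⟨w, hw, haxi, hdecay, hne⟩ := BlowupAlternative_holds u p hsol hr2 hp1 hp2 hsing
  exact hne (KNSS2009_liouville_bound_C_over_r_holds hw haxi hdecay)

/-- **Theorem 1.1 given the swirl bound, in the shape of the named fact**: the implication
`MeridionalTypeIRegularity`'s conclusion holds for every `(u, p)` that in addition satisfies
(as7). [cite: SereginSverak2009, Thm 1.1 (arXiv p. 3), Lemma 3.3 (as1) (p. 9)] -/
theorem meridionalTypeIRegularity_of_swirlBound
    (u : ℝ → EuclideanSpace ℝ (Fin 3) → EuclideanSpace ℝ (Fin 3))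
    (p : ℝ → EuclideanSpace ℝ (Fin 3) → ℝ)
    (hsol : IsAxisymmetricLocalSolution u p) (hr2 : IsBoundedAwayFromZero u)
    (hmer : IsMeridionalTypeIOnCyl u) {C₂ : ℝ}
    (hsw : ∀ᵐ z ∂(volume.restrict (parCyl 0 1)), |swirl (u z.1) z.2| ≤ C₂) :
    IsRegularAtOrigin u :=
  isRegularAtOrigin_of_meridionalTypeI_of_swirlBound hsol hr2 hmer ⟨C₂, hsw⟩

/-- **Theorem 1.1 given the swirl bound on `Q(1/2)` only — the printed reach of Lemma 3.3**
((as1): `sup_{Q(1/2)} |ϱ v_φ| ≤ …`; (as7) is used on `Q(1/2) ⊇ Q(z_b, r)`): reduced to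
`isRegularAtOrigin_of_meridionalTypeI_of_swirlBound` by the zoom `ũ(s, y) = ½ u(s/4, y/2)`
(`Q = Φ⁻¹(Q(1/2))`; "The general case is obtained by re-scaling", §3 p. 9), which preserves the
standing assumptions (`isAxisymmetricLocalSolution_rescale`), (r2)
(`isBoundedAwayFromZero_rescale`) and (1.1) (`ae_meridionalRate_shiftZoom`), and carries the
swirl bound from `Q(1/2)` to `Q` (`swirl_axis_zoom_self`); regularity of the origin pulls back
(`isRegularAtOrigin_of_rescale`). With Lemma 3.3 this is exactly the named fact
`MeridionalTypeIRegularity`. [cite: SereginSverak2009, Thm 1.1 (arXiv p. 3), Lemma 3.3 (as1) and (as7) (p. 9)] -/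
theorem isRegularAtOrigin_of_meridionalTypeI_of_swirlBound_half
    {u : ℝ → EuclideanSpace ℝ (Fin 3) → EuclideanSpace ℝ (Fin 3)}
    {p : ℝ → EuclideanSpace ℝ (Fin 3) → ℝ}
    (hsol : IsAxisymmetricLocalSolution u p) (hr2 : IsBoundedAwayFromZero u)
    (hmer : IsMeridionalTypeIOnCyl u)
    (hsw : ∃ C₂ : ℝ, ∀ᵐ z ∂(volume.restrict (parCyl 0 (1 / 2))), |swirl (u z.1) z.2| ≤ C₂) :
    IsRegularAtOrigin u := by
  obtain ⟨C, hC⟩ := hmer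
  obtain ⟨C₂, hC₂⟩ := hsw
  have hc : (0 : ℝ) < 2⁻¹ := by norm_num
  have hc1 : (2⁻¹ : ℝ) ≤ 1 := by norm_num
  have ht₀ : (0 : ℝ) ≤ 0 := le_rfl
  have ht₁ : (-1 : ℝ) ≤ 0 - (2⁻¹ : ℝ) ^ 2 := by norm_num
  set v := (2⁻¹ : ℝ) • stPull ((2⁻¹ : ℝ) ^ 2) (2⁻¹ : ℝ) 0 ((0 : ℝ) • eZ) u with hv
  set q := ((2⁻¹ : ℝ) ^ 2) • stPull ((2⁻¹ : ℝ) ^ 2) (2⁻¹ : ℝ) 0 ((0 : ℝ) • eZ) p with hq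
  have hsol' : IsAxisymmetricLocalSolution v q :=
    isAxisymmetricLocalSolution_rescale hsol hc hc1 ht₀ ht₁
  have hr2' : IsBoundedAwayFromZero v := isBoundedAwayFromZero_rescale hr2 hc hc1 ht₀ ht₁
  have hmer' : IsMeridionalTypeIOnCyl v := ⟨C, ae_meridionalRate_shiftZoom hC hc hc1 ht₀ ht₁⟩
  -- the swirl bound on `Q(1/2)` pulls back to `Q = Φ⁻¹(Q(1/2))`
  have hpre : stAffine ((2⁻¹ : ℝ) ^ 2) (2⁻¹ : ℝ) 0 ((0 : ℝ) • eZ) ⁻¹' parCyl 0 (1 / 2) =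
      parCyl 0 1 := by
    have h := stAffine_preimage_parCyl hc 0 ((0 : ℝ) • eZ) (1 / 2)
    rw [prod_zero_zero_smul_eZ] at h
    rw [h]
    norm_num
  have hsw' : ∀ᵐ z ∂(volume.restrict (parCyl 0 1)), |swirl (v z.1) z.2| ≤ C₂ := by
    have h1 := ae_restrict_preimage_stAffine (sq_pos_of_pos hc) hc 0 ((0 : ℝ) • eZ) hC₂
    rw [hpre] at h1
    filter_upwards [h1] with z hz
    rw [stAffine_fst, stAffine_snd] at hz
    have hfun : v z.1 = fun y => (2⁻¹ : ℝ) • u (0 + (2⁻¹ : ℝ) ^ 2 * z.1)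
        ((0 : ℝ) • eZ + (2⁻¹ : ℝ) • y) := rfl
    rw [hfun, swirl_axis_zoom_self cylRadius_zero_smul_eZ (2⁻¹ : ℝ)
      (u (0 + (2⁻¹ : ℝ) ^ 2 * z.1)) z.2]
    exact hz
  exact isRegularAtOrigin_of_rescale hc
    (isRegularAtOrigin_of_meridionalTypeI_of_swirlBound hsol' hr2' hmer' ⟨C₂, hsw'⟩)

end SereginSverak2009

end Literature.Analysis.FluidPDE
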